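import Summits.BirchSwinnertonDyer.BirchSwinnertonDyer.Theorems.KolyvaginDepthDoorDepthTableKuriharaRow389a1
import Summits.BirchSwinnertonDyer.BirchSwinnertonDyer.Theorems.KolyvaginDepthDoorMSymbolCert389a1
import HarnessLib

/-!
# Route `KolyvaginDepthDoor`, crux `KolyvaginDepthSupplyKN` (stmt-BirchSwinnertonDyer-22820) —
# DEPTH TABLE v27: ROW `389a1` @ `(5, 41·61)` WITH ITS E-SIDE KURIHARA CLAIM DISCHARGED BY THE KERNEL

Helper file of the lead prover of line `levelone` (kdd-p1 g31; `--supports stmt-BirchSwinnertonDyer-22820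
--as helper`); it closes nothing and BSD is NOT proved by it.

Until v26 every row of the depth table took the curve's mod-`p` Kurihara number as a CLAIM
(`KuriharaCertificates.Record.Claim`: the output of PARI `msfromell`, a trusted external computation; for
row `389a1` the hypotheses `hδE`, `hδT` of `C389a1.cruxBody_of_kuriharaClaims_5_neg7`). v27 PROVES the
E-side claim: `C389a1.kuriharaClaim_5_2501` is literally the hypothesis `hδE` — for every modular
parametrisation datum `D` of `389a1` at level `N_E` (and, as the claim is stated, under its two normalisation
hypotheses, which the proof does not even use) the Kurihara number `δ_{2501}(D.f, 5, ψ) ≠ 0` for surjective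
discrete logarithms `ψ` — by the kernel-certified plus M-symbol of `389a1` (`…MSymbolCert389a1`: eigenvector
on `ℙ¹(ℤ/389)`, uniqueness certificate, Manin-trick chains, period normalisation, Kurihara sum, all `decide`)
on top of the tree's PROVED M-symbol theory (Manin, Merel, Popa–Zagier; `finsum_smul_msymbol_eq`,
`exists_chain`, `plusPeriod`, `norm_ratPlusSymbol_le_one`). Hence the row
`C389a1.cruxBody_of_kuriharaClaimT_5_neg7`: the clause of `KolyvaginDepthSupplyKN` at `389a1` for every `K`
with `d_K = −7`, CONDITIONAL on the four named print facts (Kim Thm. 1.11, modularity, Mazur Cor. 4.1,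
W. Zhang L8.4 (1)/9.1) and on the TWIST-side claim `hδT` (`19061a1` @ `(5, 211)`, level `19061 = 389·7²`,
not prime — outside kit 1's prime-level indexing) ONLY. Per curve; nothing class-wide; (S♭) untouched;
BSD is NOT proved by any of this.

References: [Kim2022StructureSelmer] Thm. 1.11, §1.4.3; [CremonaAlgorithms1997] §2.2–2.5, Table 1 (389a1);
[PopaZagier2017] Thm. 1, §4–5; [WZhang2014] Lemma 8.4 (1), Thm. 9.1; [Mazur1978] Cor. 4.1.
-/

set_option linter.dupNamespace false

noncomputable section

open scoped Classical NumberField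

namespace Summit.BirchSwinnertonDyer.BirchSwinnertonDyer.Theorems.KolyvaginDepthDoor

open Literature.NumberTheory.EllipticCurves Literature.NumberTheory.EllipticCurves.ModularForms
  WeierstrassCurve NumberField IsDedekindDomain
open Summit.BirchSwinnertonDyer.BirchSwinnertonDyer.Theorems
open Summit.BirchSwinnertonDyer.BirchSwinnertonDyer.Rank2Observatory

namespace C389a1

/-- **THE E-SIDE KURIHARA CLAIM OF ROW `389a1` @ `(5, 41·61)` IS A THEOREM.** Literally the hypothesis `hδE`
of `cruxBody_of_kuriharaClaims_5_neg7` (the shape of `KuriharaCertificates.Record.Claim` for the record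
`cert_389a1` @ `(5, 2501)`): for every modular parametrisation datum `D` of `389a1` at level `N_E` there are
surjective `ψ_ℓ : (ℤ/ℓ)ˣ → ℤ/5` (`ℓ = 41, 61`) with `kuriharaNumber D.f 5 2501 ψ ≠ 0` — by the kernel-certified
plus M-symbol of `389a1` (`MSymbolCert.Cert389a1.exists_kuriharaNumber_ne_zero_389a1`, `N_E = 389` by
`conductorNorm_eq`); the Manin-constant and period-transfer hypotheses of the claim are not used.
[cite: Kim2022StructureSelmer, §1.4.3] [cite: CremonaAlgorithms1997, §2.2–2.5] -/
theorem kuriharaClaim_5_2501 :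
    haveI := curve389a1_isGloballyMinimal; haveI := curve389a1_neZero_conductorNorm;
    haveI := Fact.mk (by norm_num : Nat.Prime 5);
    ∀ (D : ModularParametrizationData Curve389a1.E (Curve389a1.E.conductorNorm ℤ)), ¬ ((5 : ℕ) : ℤ) ∣ D.maninConstant →
      (∃ u : ℚ, ‖(u : ℚ_[5])‖ = 1 ∧ Curve389a1.E.realPeriodRat = u * plusPeriod D.f) →
      ∃ ψ : (ℓ : ℕ) → (ZMod ℓ)ˣ →* Multiplicative (ZMod 5),
        (∀ ℓ ∈ (2501 : ℕ).primeFactors, Function.Surjective (ψ ℓ)) ∧ kuriharaNumber D.f 5 2501 ψ ≠ 0 := by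
  intro D _ _
  haveI := curve389a1_neZero_conductorNorm
  exact MSymbolCert.Cert389a1.exists_kuriharaNumber_ne_zero_389a1 _ conductorNorm_eq D

/-- **DEPTH-TABLE ROW `389a1`, `(p, d_K) = (5, −7)`, v27 — E-SIDE CLAIM DISCHARGED.** For every imaginary
quadratic `K` with `d_K = −7`: granted Kim 2026 Thm. 1.11 (`hKim`), modularity (`hnf`), Mazur 1978 Cor. 4.1
(`hMaz`), W. Zhang 2014 L8.4 (1)/9.1 (`h84`) BY NAME and the TWIST-side claim `hδT` of the tree record
`cert_19061a1` @ `(5, 211)`, the clause of the crux `KolyvaginDepthSupplyKN` holds at `W = 389a1` VERBATIM —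
v17's `cruxBody_of_kuriharaClaims_5_neg7` with its E-side claim `hδE` PROVED (`kuriharaClaim_5_2501`).
CONDITIONAL on the four named facts and ONE claim; per curve; nothing class-wide; BSD is not proved by it.
[cite: Kim2022StructureSelmer, Thm. 1.11 (PDF p. 8)] [cite: WZhang2014, Lemma 8.4 (1) (p. 236), Thm. 9.1 (p. 240)]
[cite: Mazur1978, Cor. 4.1] [cite: CremonaAlgorithms1997, Table 1 (389a1)] -/
theorem cruxBody_of_kuriharaClaimT_5_neg7
    (hKim : Kim2022_card_selmerGroup_le_pow_of_kuriharaNumber_ne_zero)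
    (hnf : exists_isNewformOf) (hMaz : mazur_not_dvd_maninConstant_of_odd)
    (h84 : Literature.NumberTheory.EllipticCurves.WZhang2014_lemma84_exists_minimal_kolyvaginClass_one_selmerCard)
    (K : Type) [Field K] [NumberField K] (hK : IsImaginaryQuadratic K) (hD : NumberField.discr K = -7)
    (hδT : haveI := minTwist7_isElliptic; haveI := minTwist7_isGloballyMinimal;
      haveI : NeZero (((⟨0, -1, 1, -114, -302⟩ : WeierstrassCurve ℤ).map (Int.castRingHom ℚ)).conductorNorm ℤ) :=
        neZero_conductorNorm_of_isElliptic _;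
      haveI := Fact.mk (by norm_num : Nat.Prime 5);
      ∀ (D : ModularParametrizationData ((⟨0, -1, 1, -114, -302⟩ : WeierstrassCurve ℤ).map (Int.castRingHom ℚ))
          (((⟨0, -1, 1, -114, -302⟩ : WeierstrassCurve ℤ).map (Int.castRingHom ℚ)).conductorNorm ℤ)),
        ¬ ((5 : ℕ) : ℤ) ∣ D.maninConstant →
        (∃ u : ℚ, ‖(u : ℚ_[5])‖ = 1 ∧
          ((⟨0, -1, 1, -114, -302⟩ : WeierstrassCurve ℤ).map (Int.castRingHom ℚ)).realPeriodRat = u * plusPeriod D.f) →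
        ∃ ψ : (ℓ : ℕ) → (ZMod ℓ)ˣ →* Multiplicative (ZMod 5),
          (∀ ℓ ∈ (211 : ℕ).primeFactors, Function.Surjective (ψ ℓ)) ∧ kuriharaNumber D.f 5 211 ψ ≠ 0) :
    haveI := curve389a1_isGloballyMinimal;
    ∃ (p : ℕ) (hp : Fact p.Prime), 5 ≤ p ∧ Curve389a1.E.HasGoodReductionAtPrime p ∧
      ¬ (p : ℤ) ∣ Curve389a1.E.frobeniusTrace p ∧ (∀ n : ℕ, Curve389a1.E.HasSurjectiveModNGaloisRep (p ^ n : ℕ)) ∧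
      (∀ v : HeightOneSpectrum (𝓞 ℚ), Curve389a1.E.HasMultiplicativeReductionAt v →
        ¬ p ∣ Curve389a1.E.ordMinimalDiscriminant v) ∧
      ∃ (K : Type) (_ : Field K) (_ : NumberField K), IsImaginaryQuadratic K ∧
        NumberField.discr K ≠ -3 ∧ NumberField.discr K ≠ -4 ∧
        ∃ (_ : NeZero (Curve389a1.E.conductorNorm ℤ)), SatisfiesHeegnerHypothesis (Curve389a1.E.conductorNorm ℤ) K ∧
        ∃ (Dt : ModularParametrizationData Curve389a1.E (Curve389a1.E.conductorNorm ℤ)) (β : ℤ) (ι : K →+* ℂ) (n₁ : ℕ)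
          (d : KolyvaginHeegnerData Dt β ι n₁), Squarefree n₁ ∧
          (∀ q ∈ n₁.primeFactors, Zhang2014.IsKolyvaginPrime (Curve389a1.E.conductorNorm ℤ) Curve389a1.E K p q) ∧
          d.kolyvaginClass hp.out 1 ≠ 0 ∧
          (n₁.primeFactors.card + 1 ≤ Curve389a1.E.mordellWeilRank ∨
            (n₁.primeFactors.card ≤ Curve389a1.E.mordellWeilRank ∧
              n₁.primeFactors.card + 1 ≤ (Curve389a1.E.quadraticTwist (NumberField.discr K : ℚ)).mordellWeilRank)) :=
  cruxBody_of_kuriharaClaims_5_neg7 hKim hnf hMaz h84 K hK hD kuriharaClaim_5_2501 hδT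

end C389a1

end Summit.BirchSwinnertonDyer.BirchSwinnertonDyer.Theorems.KolyvaginDepthDoor

end
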